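import Mathlib
import HarnessLib
import HarnessLib.Audit
import Summits.ABC.ABC.Statement

/-!
Route: InterimDiophValNum

CLOSED (superseded) 2026-08-15T12:48:14Z by planner-ABC-route-ABC-InterimDiophValNum-0 — reason: superseded:route-ABC-CMRescueSzpiro — superseded by route-ABC-CMRescueSzpiro — note: route-repair (planner, 2026-08-15): SUPERSEDED. This interim carry-over of abc.S10 held two statements, `AbcConjectureIffModifiedSzpiro : ABC ↔ ModifiedSzpiroConjecture` (stmt-ABC-0001, filed as crux) and `SzpiroOfAbcConjecture : ABC → SzpiroConjecture` (stmt-ABC-0002, support). Both are now DISCHAR. The file is kept as the record of this route; refuted decls are indexed as negative knowledge (`ledger negatives`).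

Carry-over of the interim blast's sorried statements ABOUT ABC from interim group G22 DiophValNum
(Szpiro / valuations) (Statements/Abc/Szpiro.lean; harness21 @ d8f2665). Thesis (to be sharpened by
the route planner, D-0014e): the equivalences/implications these 2 statements assert
(abcConjecture_iff_modifiedSzpiro, szpiro_of_abcConjecture) hold and, combined, bear on ABC. They
enter as UNSTAMPED statement items: grounder first (most are cited results -> named facts in
Literature), then refuter, then provers.

Rationale: M5 migration (docs/m5/PLAN.md 2c‴ as amended by D-0014b): no workspace, no THESIS.md; the interim
decl text is in run/m5/workspaces/ for the operator and quoted in each item's --informal.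

History (route lifecycle, newest last):
- 2026-08-15T12:48:14Z · CLOSED superseded — superseded:route-ABC-CMRescueSzpiro (planner-ABC-route-ABC-InterimDiophValNum-0)

sub-problem: ABC · status: closed(superseded) · opened operator:999:2871179 2026-08-13T05:39:08Z · rev 0 · ledger route-ABC-InterimDiophValNum
GENERATED by the gate from the ledger (D-0016/17). Provers cite these decls: `theorem foo : Summit.ABC.ABC.Theses.InterimDiophValNum.<Decl> := …` in Summits/ABC/ABC/Theorems/<Name>.lean.
-/

namespace Summit.ABC.ABC.Theses.InterimDiophValNum

open scoped BigOperators Topology Manifold Classical MeasureTheory ProbabilityTheory Matrix InnerProductSpace ComplexConjugate ContinuousMap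
open Filter Set Function TopologicalSpace MeasureTheory

attribute [summit_statement] _root_.ABC

open Literature.Abc

-- TODO item stmt-ABC-0001 · crux · rank 2 · closed · moot by None · by operator — BLOCKED: missing decl(s) ABCConjecture, ModifiedSzpiroConjecture; restate via `ledger route edit` once they land:
--   def AbcConjectureIffModifiedSzpiro : Prop := ABCConjecture ↔ ModifiedSzpiroConjecture

-- TODO item stmt-ABC-0002 · support · rank 3 · closed · moot by None · by operator — BLOCKED: missing decl(s) ABCConjecture, SzpiroConjecture; restate via `ledger route edit` once they land:
--   def SzpiroOfAbcConjecture : Prop := ABCConjecture → SzpiroConjecture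

end Summit.ABC.ABC.Theses.InterimDiophValNum
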